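import Literature.MathematicalPhysics.QuantumFieldTheory.Volkov2024PRD109.ForestFormulaCases
import Literature.MathematicalPhysics.QuantumFieldTheory.Volkov2024PRD109.WardIdentityPreservation
import HarnessLib

/-!
# Volkov PRD 109, 036012 (2024) §IV A «the in-place on-shell renormalization» AS PRINTED — the expression Σ_{F={G,G₁,…,G_n}∈𝔉[G]} (−1)^n A_G S_{G₁}…S_{G_n} with S = L / B / U₀ by subgraph kind, typed over `ForestFormulaCases`' forests; §IV B's «2-loop examples are given in [69] … each operator U should be replaced by U₁ or U₀» EXECUTED: [69]'s 2-loop on-shell table (ZhETF 149 (2016) p.1170 Table 1, both columns) certified row by row against that expression and against `ForestFormulaCases.table2_2016`, before and after the substitution; [69] §4's two-line lemma («UΣ = Σ(m) − C(p̂ − m)», «(U − B)Σ = −C₁(p̂ − m)») PROVED in the γ-algebra vocabulary of `WardIdentityPreservation` with §IV A's B — and ONE PRINT-CHECK DATUM: [69] eq. (17) prints B's bracket as b(m²) + 2a′(m²) + 2m b′(m²), §IV A prints s(m²) + 2m r′(m²) + 2m² s′(m²); [69]'s own second claim holds for every Ward pair iff the §IV A form is used (with (17) as printed: iff (m − 1)(a′(m²)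 + m b′(m²)) = 0)

independent recomputation; certified where stated, statistical where stated; no new-physics claim.

CITATION HEADER (venture `QEDPrecision`, cell `pub-qed`, track TROPICAL seat V3b = `pub-qed-trop-v3-lit-2` gen 36; VALUE-FREE: combinatorics of
printed OPERATOR EXPRESSIONS (which operator symbol acts on which subgraph, with which sign) and identities between printed OPERATOR FORMULAS on the
abstract amplitude shapes (8)/(13) in an abstract γ-algebra and in M₄(ℂ) — no integral, no value of any order ([69]'s Table 2 VALUE columns are
NOT typed), no graph of the cell, nothing per word, nothing of X352). Third file of the §IV story after `OnShellEquivalenceWardCancellation`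
(gen 34: §IV B TABLE I summed and cancelled) and `WardIdentityPreservation` (gen 35: U, L, B, M′ on the shapes (8)/(13); «U preserves the Ward
identity»; «L′Γ₁ = −B′Σ₁»); companion of `ForestFormulaCases` (literature seat: the forest-formula CASE TABLES M15 / M19 / S23 and every printed
operator expression of the SUBTRACTION side, incl. [69]'s Table 2 = `table2_2016`). This file types the ON-SHELL side of §IV A and the 2-loop
equivalence check §IV B delegates to [69]. Serves HOME `tropical/view/V3-VOLKOV-DEGREES.md` §B B.4 / B.61–B.63.

Sources, VERBATIM (LaTeX e-prints held by the cell, HOME `data/lit/sources/.cache/<arXiv id>/`; arXiv page:line = the PDF as materialised by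
`lit read arxiv:2308.11560`; [69]'s JOURNAL pages = HOME `data/lit/sources/.cache/journal-pdf-pages/ZhETF149-1164-Volkov2016/` (Russian original
ZhETF 149 (6) 1164–1191 (2016), PDF page N = journal page 1163+N; the English JETP 122, 1008 pages are not held — acq-09812, cite-only)).
* [Volkov2024PRD109] S. Volkov, Phys. Rev. D 109, 036012 (2024) = arXiv:2308.11560v4 (`method_details_2023.tex`). §IV A «Definition» (p.11
  L4–L37; tex l.467–485): «The definition of on-shell renormalization is well known for the coefficients of the expansion in α, but it requires
  a definition for subsets of Feynman graphs. We define it as the sum of the individual graph contributions obtained by the in-place on-shell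
  renormalization. It can be written in terms of expressions such as those used above. The expression for a graph G is
  Σ_{F={G,G₁,…,G_n}∈𝔉[G]} (−1)^n A_G S_{G₁} … S_{G_n}, where S_{G′} = L_{G′}, if G′ is a vertexlike graph, B_{G′}, if G′ is a lepton
  self-energy graph, (U₀)_{G′}, if G′ is a photon self-energy or photon-photon scattering graph; here (BΣ)(p) = [B′Σ]×(p̸ − m) + M′Σ,
  B′Σ = s(m²) + 2m ∂r(x)/∂x|_{x=m²} + 2m² ∂s(x)/∂x|_{x=m²}, where (13) and (14) are satisfied.» (p.11 L38–L39; tex l.487): «The multipliers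
  S_{G′} for photon-photon scattering graphs G′ can be omitted in gauge-invariant classes …». §IV B «Examples», first paragraph (p.11 L41–L42;
  tex l.491): «2-loop examples are given in [69] for the old version of the method. In the new version each operator U should be replaced by
  U₁ or U₀.» §III (tex l.405, l.411): «A_G − A_G (U₁)_{abc} − (L−U₁)_G A_{abc}», «A_G − A_G (U₁)_{bc}» (the 2-loop ladder and self-energy
  examples in 2023 notation). §IV C (p.14 L36–L43; tex l.610): «A layer tree is a rooted tree, each node of it is (l, O, r), where l is a
  layer; O is one of the operators A′, U_j′, L′, L′ − U_j′, M′, B′ … The contribution of the layer tree (without coefficient) is the product of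
  the node values, where the value of the node (l, O, r) is OΓ_l». §II (8), (12)–(14) and §II's L, U as quoted in `WardIdentityPreservation`.
  Reference [69] (p.29): «S. Volkov, Subtractive procedure for calculating the anomalous electron magnetic moment in QED and its application for
  numerical calculation at the three-loop level, Zh. Eksp. Teor. Fiz. 149, 1164 (2016), [JETP 122, 1008 (2016)]» = [Volkov2016].
* [Volkov2016] = [69]. §2.2, ZhETF p.1167 (PDF p.4 L95–L110) = arXiv:1507.06435v3 (`amm_article_arxiv.tex`) l.317–339: «Если через Σ(p)
  обозначается фейнмановская амплитуда, соответствующая электронному собственно-энергетическому подграфу, (6) Σ(p) = a(p²) + b(p²)p̂, то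
  UΣ(p) = a(m²) + b(m²)p̂ (заметим, что это отличается от обычной перенормировки на массовой поверхности). • Если … вершинному подграфу,
  (7) Γ_μ(p,0) = a(p²)γ_μ + b(p²)p_μ + c(p²)p̂p_μ + d(p²)(p̂γ_μ − γ_μp̂), то (8) UΓ_μ = a(m²)γ_μ.» [the e-print, l.337: «UΓ_μ = (a(m²) + C_U
  d(m²))γ_μ, where C_U is an arbitrary constant» — typed with C_U; the journal's (8) is C_U = 0]; p.1168 (PDF p.5 L2–L9) = tex l.341–351:
  «L — оператор, используемый при перенормировке на массовой поверхности … (9) LΓ_μ = [a(m²) + m b(m²) + m² c(m²)]γ_μ». §4, p.1170 (PDF p.7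
  L61–L74) = tex l.546–559: «Перенормировка на массовой поверхности может быть представлена в форме, аналогичной той, которая использовалась
  в разд. 2.2, см. табл. 1. Здесь B — оператор, применяемый к фейнмановским амплитудам электронных собственно-энергетических подграфов при
  перенормировке на массовой поверхности, определяемый равенством (17) BΣ(p) = Σ(m) + (p̂ − m)(b(m²) + 2a′(m²) + 2m b′(m²)) (если
  выполнено (6))» [On-shell renormalization can be represented in a form analogous to the one used in §2.2, see Table 1. Here B is the
  operator applied to the Feynman amplitudes of electron self-energy subgraphs in the on-shell renormalization, defined by (17) (if (6) holds);
  e-print: «B is the operator that is applied to Feynman amplitudes of electron self-energy subgraphs for the on-shell renormalization. This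
  operator is defined by the following relation: BΣ(p) = Σ(m) + (p̂ − m)(b(m²) + 2a′(m²) + 2m b′(m²))»], fn 10 (L133): «Здесь по определению
  Σ(m) = a(m²) + m b(m²)» [by definition Σ(m) = a(m²) + m b(m²)]. TABLE 1 (p.1170 top, PDF p.7 L2–L27; = the e-print's Table
  `table_2loop_onshell`, tex l.561–583), caption «Операторные выражения для вкладов графов Фейнмана из рис. 2 в АММ электрона, вычисляемых
  прямым вычитанием на массовой поверхности, а также разности между ними и выражениями из табл. 2» [Operator expressions for the
  contributions of the Feynman graphs of Fig. 2 to the electron AMM obtained by direct on-shell subtraction, and the differences between them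
  and the expressions of Table 2; e-print: «… that are obtained directly by on-shell renormalization, the differences between these expressions
  and expressions from Table [2]»], columns № / «Операторное выражение» (operator expression) / «Разность» (difference): «1: A_G − A_G L_abc | (L_G − U_G)A_abc − A_G(L_abc − U_abc); 2: A_G | 0; 3: A_G − A_G L_bcd | A_G(U_bcd − L_bcd); 4: A_G −
  A_G L_bcd | A_G(U_bcd − L_bcd); 5: A_G − A_G B_bc | A_G(U_bc − B_bc); 6: A_G − A_G B_bc | A_G(U_bc − B_bc); 7: A_G − A_G U_de | 0» [the
  e-print, tex l.572–574, prints rows 3–4 of the last column as «A_G(U_{abc} − L_{abc})»]. The lemma (p.1170, PDF p.7 L75–L89 = tex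
  l.585–601): «Из табл. 1 видно, что вклад графа 1 в разность a_{e,1} − a^new_{e,1} равен нулю. Теперь рассмотрим суммарный вклад графов 3–6
  в эту разность. Заметим, что если для некоторых функций Σ(p) и Γ_μ(p,q) возможны представления (6) и (7), а также при любом p имеет место
  тождество Уорда Γ_μ(p,0) = −∂Σ(p)/∂p^μ и выполнено UΓ_μ = Cγ_μ, то будет справедливо равенство UΣ(p) = Σ(m) − C(p̂ − m). Если при этих же
  предположениях выполнено (U − L)Γ_μ = C₁γ_μ, то имеет место (U − B)Σ(p) = −C₁(p̂ − m). Из этого следует, что вклад графов 3–6 в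
  a_{e,1} − a^new_{e,1} равен нулю.» [Table 1 shows that the contribution of graph 1 to the difference a_{e,1} − a^new_{e,1} is zero. Now
  consider the total contribution of graphs 3–6 to this difference. Note that if for some functions Σ(p) and Γ_μ(p,q) the representations (6)
  and (7) are possible, and for every p the Ward identity Γ_μ(p,0) = −∂Σ(p)/∂p^μ holds and UΓ_μ = Cγ_μ, then UΣ(p) = Σ(m) − C(p̂ − m). If under
  the same assumptions (U − L)Γ_μ = C₁γ_μ, then (U − B)Σ(p) = −C₁(p̂ − m). From this it follows that the contribution of graphs 3–6 to
  a_{e,1} − a^new_{e,1} is zero; e-print: «Suppose the functions Σ(p), Γ_μ(p,q) and the complex number C satisfy … then UΣ(p) = Σ(m) −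
  C(p̂ − m). Also, if additionally (U − L)Γ_μ = C₁γ_μ, then (U − B)Σ(p) = −C₁(p̂ − m). From this it follows that the contribution of graphs
  3–6 is equal to zero.»]. Table 2's operator-expression column (p.1172) is `ForestFormulaCases.table2_2016` (typed there, VERBATIM).
* [Volkov2024] S. Volkov, Phys. Rev. D 110, 036001 (2024) = arXiv:2404.00649v2 §III (6)–(7) and «In old calculations we used M² = m²» — as
  quoted in `WardIdentityPreservation` (`SelfEnergy.uAmp`, `uAmp_self`).

TYPING. §1–§3 are COMBINATORICS over `ForestFormulaCases`: `Kind` (the four UV-divergent subgraph kinds), `Sym` = that file's `Op` plus `B`;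
`S_IVA` = §IV A's case list AS PRINTED; `S_69` = the operators [69]'s Table 1 applies (L / B / U by kind ⟦read off its rows — [69] prints
examples, not a case list⟧); `subst2L` = §IV B's substitution on the 2-loop examples (U ↦ U₀ on the photonic subgraph, U ↦ U₁ otherwise,
(L − U) ↦ (L − U₁), as §III prints them). A worked example WITH KINDS (`KExample`) forgets to that file's `Example` — so «𝔉[G]» IS
`Example.forests` — and `onShellTerms` is §IV A's sum. Printed expressions are typed with NAMED subgraphs and brackets as printed (`NExpr`),
expanded (`expandN`), names resolved against the example (`resolveAll`); DIFFERENCES are compared as formal ℤ-combinations of products of single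
operators (`fsEq`), reading «(L_{G″} − U_{G″})» as L − U (`unfoldAll`). §4 is ALGEBRA in `WardIdentityPreservation`'s vocabulary (`SelfEnergy`,
`Vertex`, `WardIdentity`, `lPrime`, `bPrime`, `mPrime`, `bAmp`, `uAmp`; p̂ = `sl γ p`): [69]'s U on Γ and Σ (`uPrime2016` with C_U,
`uAmp2016`), Σ(m) (`sigmaAtM`), and (17)'s B AS PRINTED (`bPrime2016`, `bAmp2016`) next to §IV A's (`SelfEnergy.bPrime`, `bAmp`).

WHAT IS PROVED (namespace `…Volkov2024PRD109.OnShell`; 0 named facts; `decide` for §1–§3):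
* `subst2L_S_69` — §IV B's substitution carries [69]'s on-shell operators onto §IV A's case list, kind by kind.
* `table1Graphs_toExample` — the seven 2-loop graphs' data, kinds forgotten, ARE `ForestFormulaCases.table2_2016_graphs`.
* **`table1OpExpr_eq_onShell`** — Table 1's «Операторное выражение» column, rows 1–7, names resolved, is EXACTLY (multiset of signed terms)
  §IV A's Σ_{F∋G} (−1)^n A_G S_{G₁}…S_{G_n} with [69]'s operators; **`table1OpExpr_subst_eq_IVA`** — after §IV B's substitution it is EXACTLY
  §IV A's sum with S = L / B / U₀.
* **`table1Diff_eq_sub`** — Table 1's «Разность» column, rows 1–7, IS (on-shell expression) − (`table2_2016` row) as formal sums;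
  **`table2_subst_eq_S23`** — `table2_2016` with §IV B's substitution is EXACTLY the 2023 case table's forest sum (`S23`, ξ = 1) for all seven
  graphs (rows 1, 5 = `ForestFormulaCases.sec3_2023_twoLoop_eq_forest`); `table1Diff_subst_eq_sub23` — the substituted difference column is the
  2023 difference. `eprintDiffRow34_resolves_iff_renamed` — the e-print's «abc» in rows 3–4 is not a subgraph of graphs 3–4; renamed bcd it is
  the journal's row.
* `row1Diff_eval_eq_zero` — «вклад графа 1 … равен нулю»: under every layer valuation (§IV C: value of a term = product of node values O′Γ_l)
  that values the ladder's two layers alike ⟦the seat's reading of why: G/abc and abc are both the one-loop vertex⟧, row 1's difference is 0.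
* **`lemma69_uSigma`** — [69]'s first claim: Ward pair (e = 1), UΓ_μ = Cγ_μ with C = a(m²) + C_U d(m²) ⇒ UΣ(p) = Σ(m)·1 − C(p̂ − m·1), every
  C_U, m (Ward forces d ≡ 0 and a = −s, [69]'s a = −b: `WardIdentity.coeff`); `sigmaAtM_eq_mPrime`, `uAmp2016_eq_uAmp_self` (= PRD 110 (7) at M² = m²).
* **`lemma69_uSubB`** — the second claim WITH §IV A's B: (U − L)Γ_μ = C₁γ_μ ⇒ (U − B)Σ(p) = −C₁(p̂ − m·1), every Ward pair, C_U, m;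
  `uAmp_sub_bAmp` — the same with PRD 110's U at general M² (C₁ = U′Γ − L′Γ), i.e. §IV B's «It equals 0, because L′Γ₁ = −B′Σ₁» mechanism.
* §5 `model_lemma69` — in the Dirac-matrix model (`Volkov2020.DiracModel`, section-local matrix norms as in `WardIdentityPreservation` §6)
  the hypotheses are met with content (U′Γ = −s(m²), L′Γ = −B′Σ).
PRINT-CHECK DATUM: **`lemma69_uSubB_asPrinted_iff`** / `bPrime_sub_bPrime2016` / `bPrime2016_eq_bPrime_one` — §IV A's B′ minus (17)'s
bracket is 2(m − 1)(r′(m²) + m s′(m²)); with (17) AS PRINTED (journal and e-print alike) [69]'s second claim holds for a Ward pair IF AND ONLY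
IF (m − 1)(a′(m²) + m b′(m²)) = 0 (so at m = 1, where the two forms coincide), with §IV A's B′ for every m. Reading: (17) omits one power of m
in each derivative term ([69] fixes ħ = c = 1 only, p.1167); PRD 109 §IV A prints the homogeneous form; [69] §4's conclusions are unaffected.
NOT CLAIMED (print / physics, not typed): that QED amplitudes have the forms (6)–(7)/(8), (13) or satisfy the Ward identities; the final step
«Из этого следует, что вклад графов 3–6 … равен нулю» (it needs the Feynman rules of the reduced graphs: S(p)(p̂ − m)S(p) = S(p) and the
pairing of graphs 3–4 with 5–6 — analysis); [69] Appendix B (Утверждения 3–4, all orders) and PRD 109 §IV C; U₀'s content; anything per graph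
of the cell; coefficient functions are REAL-valued (TODO(general form): values in ℂ, as in `WardIdentityPreservation`).
-/

noncomputable section

open Finset
open Literature.MathematicalPhysics.QuantumFieldTheory.Volkov2020.AppendixNumerators

namespace Literature.MathematicalPhysics.QuantumFieldTheory.Volkov2024PRD109

namespace OnShell

/-! ## §1 Subgraph kinds, the operator alphabet with `B`, the printed S-table of §IV A and the §IV B substitution -/

/-- The four kinds of UV-divergent subgraphs (PRD 110 §III: lepton self-energy, vertexlike, photon self-energy, photon-photon scattering),
by which §IV A's case list for `S_{G′}` is indexed. [cite: Volkov2024PRD109, §IV A (arXiv v4 p.11 L8–L11; tex l.475–479)] -/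
inductive Kind
  | vertex | leptonSE | photonSE | photonPhoton
  deriving DecidableEq, Repr

/-- Operator symbols: those of the forest-formula case tables (`ForestFormulaCases.Op`: A, L, U, (L − U), U₀, U₁, U₂, U₃, (L − U₁)) and the
on-shell lepton self-energy operator `B` of §IV A / [69] eq. (17). [cite: Volkov2024PRD109, §IV A (arXiv v4 p.11 L8–L13; tex l.475–483)] -/
inductive Sym
  | op (o : Op)
  | B
  deriving DecidableEq, Repr

/-- §IV A AS PRINTED: «S_{G′} = L_{G′}, if G′ is a vertexlike graph, B_{G′}, if G′ is a lepton self-energy graph, (U₀)_{G′}, if G′ is a photon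
self-energy or photon-photon scattering graph». [cite: Volkov2024PRD109, §IV A (arXiv v4 p.11 L8–L11; tex l.475–479)] -/
def S_IVA : Kind → Sym
  | .vertex => .op .L
  | .leptonSE => .B
  | .photonSE => .op .U0
  | .photonPhoton => .op .U0

/-- The operators [69] = ZhETF 149, 1164 (2016) §4 uses for «перенормировка на массовой поверхности … в форме, аналогичной той, которая
использовалась в разд. 2.2, см. табл. 1»: L on vertexlike subgraphs (its (9)), B on electron self-energy subgraphs (its (17)), and on the
photon-polarisation subgraph of graph 7 the Taylor operator U of its §2.2 (Table 1 row 7 «A_G − A_G U_de») ⟦the three entries are READ OFF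
Table 1's rows; [69] prints no case list — PRD 109 §IV A does, with the 2023 name U₀⟧.
[cite: Volkov2016, §4 Table 1 and eq. (17) (ZhETF 149 p.1170 = journal PDF p.7; arXiv:1507.06435v3 tex l.551–583)] -/
def S_69 : Kind → Sym
  | .vertex => .op .L
  | .leptonSE => .B
  | .photonSE => .op .U
  | .photonPhoton => .op .U

/-- §IV B «2-loop examples are given in [69] for the old version of the method. In the new version each operator U should be replaced by U₁
or U₀»: on the 2-loop examples (no subgraph has its external leptons on a lepton loop) U ↦ U₀ on photonic subgraphs, U ↦ U₁ otherwise, and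
(L − U) ↦ (L − U₁) (PRD 109 §III prints «A_G − A_G (U₁)_{abc} − (L − U₁)_G A_{abc}», «A_G − A_G (U₁)_{bc}»).
[cite: Volkov2024PRD109, §IV B first paragraph (arXiv v4 p.11 L29–L30; tex l.491); §III 2-loop examples (tex l.405, l.411)] -/
def subst2L (k : Kind) : Sym → Sym
  | .op .U => if k = .photonSE ∨ k = .photonPhoton then .op .U0 else .op .U1
  | .op .LsubU => .op .LsubU1
  | x => x

/-- The §IV B substitution carries [69]'s on-shell operators to §IV A's case list, kind by kind.
[cite: Volkov2024PRD109, §IV A–B (arXiv v4 p.11; tex l.475–491)] -/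
theorem subst2L_S_69 : ∀ k : Kind, subst2L k (S_69 k) = S_IVA k := by
  intro k; cases k <;> rfl

/-! ## §2 Worked-example data with kinds; the in-place on-shell forest sum of §IV A over `ForestFormulaCases`' forests -/

/-- One proper UV-divergent subgraph of a printed 2-loop example: printed name (vertex enumeration), its kind, printed membership in 𝕴[G]/I[G],
and whether its external leptons sit on a lepton loop (never, in the 2-loop examples). [cite: Volkov2016, §4 Table 1, Table 2 (ZhETF 149 p.1170, p.1172)] -/
structure KSub where
  /-- printed name = vertex enumeration -/
  name : String
  /-- printed vertex list -/
  verts : List String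
  /-- kind of UV-divergent subgraph -/
  kind : Kind
  /-- printed: member of 𝕴[G] (resp. I[G]) -/
  inI : Bool
  /-- external leptons on a lepton loop (2023 attribute) -/
  onLoop : Bool
  deriving DecidableEq, Repr

/-- leptonic kinds (vertexlike / lepton self-energy) (plumbing) [folklore] -/
def Kind.isLeptonic : Kind → Bool
  | .vertex => true
  | .leptonSE => true
  | .photonSE => false
  | .photonPhoton => false

/-- Forget the kind into `ForestFormulaCases`' 2023 attributes: main path / lepton loop / photonic. (plumbing) [folklore] -/
def KSub.toSub (s : KSub) : Sub :=
  { name := s.name, verts := s.verts, inI := s.inI,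
    main := s.kind.isLeptonic && !s.onLoop, loop := s.kind.isLeptonic && s.onLoop, phot := !s.kind.isLeptonic }

/-- A printed worked example with kinds: proper UV-divergent subgraphs (members `1 … n`; member `0` = G, vertexlike) and the printed overlapping
pairs. [cite: Volkov2016, §4 Table 1 (ZhETF 149 p.1170)] -/
structure KExample where
  /-- proper UV-divergent subgraphs with kinds -/
  subs : List KSub
  /-- printed overlapping pairs -/
  overlaps : List (ℕ × ℕ)
  deriving Repr

namespace KExample

variable (ex : KExample)

/-- the underlying `ForestFormulaCases.Example` (same members, same forests) (plumbing) [folklore] -/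
def toExample : Example := { subs := ex.subs.map KSub.toSub, overlaps := ex.overlaps }

/-- the kind of member `i` (`0` = the whole vertexlike graph G) (plumbing) [folklore] -/
def kindOf (i : ℕ) : Option Kind := if i = 0 then some .vertex else (ex.subs[i - 1]?).map KSub.kind

/-- resolve a printed subgraph name to its member index («G» = 0; «in this table by G we denote the whole graph»). (plumbing) [folklore] -/
def resolve (nm : String) : Option ℕ :=
  if nm = "G" then some 0
  else ((List.range ex.subs.length).find? fun i => (ex.subs[i]?).map KSub.name = some nm).map (· + 1)

end KExample

/-- A signed term: sign and operator assignment (member index, symbol), sorted by member index. (plumbing) [folklore] -/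
abbrev Term := Int × List (ℕ × Sym)

/-- canonical order of an assignment (by member index) (plumbing) [folklore] -/
def canon (l : List (ℕ × Sym)) : List (ℕ × Sym) := l.insertionSort fun a b => a.1 ≤ b.1

/-- **§IV A's in-place on-shell renormalisation expression** «Σ_{F={G,G₁,…,G_n}∈𝔉[G]} (−1)^n A_G S_{G₁} … S_{G_n}» for the subgraph data `ex` and
an operator table `S` (by kind), over the SAME forests 𝔉[G] as the forest formula (`ForestFormulaCases.Example.forests`).
[cite: Volkov2024PRD109, §IV A (arXiv v4 p.11 L4–L11; tex l.469–479)] -/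
def KExample.onShellTerms (ex : KExample) (S : Kind → Sym) : List Term :=
  ex.toExample.forests.map fun K =>
    ((if K.length % 2 == 0 then (1 : Int) else -1),
      canon ((0, Sym.op Op.A) :: K.filterMap fun i => (ex.kindOf i).map fun k => (i, S k)))

/-- lift a forest-formula term (`ForestFormulaCases`) into the alphabet with `B` (plumbing) [folklore] -/
def liftTerm (t : Example.Term) : Term := (t.1, t.2.map fun q => (q.1, Sym.op q.2))

/-- «(L_{G″} − U_{G″})» MEANS L − U: unfold the bracket symbols (L − U), (L − U₁) of the case tables into two terms each, so that expressions
are compared as formal ℤ-combinations of products of the single operators A, L, U, B, U₀, U₁, …. (plumbing) [folklore] -/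
def unfoldOne : (ℕ × Sym) → List (Int × (ℕ × Sym))
  | (i, .op .LsubU) => [(1, (i, .op .L)), (-1, (i, .op .U))]
  | (i, .op .LsubU1) => [(1, (i, .op .L)), (-1, (i, .op .U1))]
  | q => [(1, q)]

/-- unfold every bracket symbol in a term (product of sums ↦ sum of products) (plumbing) [folklore] -/
def unfoldTerm (t : Term) : List Term :=
  (t.2.foldl (fun acc q => acc.flatMap fun u => (unfoldOne q).map fun v => (u.1 * v.1, u.2 ++ [v.2])) [(t.1, [])]).map
    fun u => (u.1, canon u.2)

/-- unfold a list of terms (plumbing) [folklore] -/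
def unfoldAll (ts : List Term) : List Term := ts.flatMap unfoldTerm

/-- the coefficient of a monomial in a formal sum (plumbing) [folklore] -/
def coeff (ts : List Term) (mono : List (ℕ × Sym)) : Int := ((ts.filter fun t => t.2 = mono).map Prod.fst).sum

/-- equality of two term lists AS FORMAL ℤ-COMBINATIONS of monomials (like terms collected). (plumbing) [folklore] -/
def fsEq (x y : List Term) : Bool := (x ++ y).all fun t => coeff x t.2 = coeff y t.2

/-- formal negation (plumbing) [folklore] -/
def fsNeg (x : List Term) : List Term := x.map fun t => (-t.1, t.2)

/-- apply the §IV B substitution to every factor of every term, by the kind of the member it acts on (plumbing) [folklore] -/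
def KExample.substTerms (ex : KExample) (ts : List Term) : List Term :=
  ts.map fun t => (t.1, t.2.map fun q => (q.1, match ex.kindOf q.1 with | some k => subst2L k q.2 | none => q.2))

/-! ### Printed expressions with NAMED subgraphs («subdiagrams are denoted by enumeration of their internal vertices») -/

/-- a printed monomial: coefficient and factors (subgraph name, operator) (plumbing) [folklore] -/
abbrev NMono := Int × List (String × Sym)

/-- a printed expression: a signed sum of products of brackets, each bracket a sum of monomials (plumbing) [folklore] -/
abbrev NExpr := List (Int × List (List NMono))

/-- «we should expand the parentheses»: a product of brackets ↦ sum of monomials (plumbing) [folklore] -/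
def expandBrackets (fs : List (List NMono)) : List NMono :=
  fs.foldl (fun acc f => acc.flatMap fun t => f.map fun m => (t.1 * m.1, t.2 ++ m.2)) [(1, [])]

/-- full expansion of a printed expression (plumbing) [folklore] -/
def expandN (e : NExpr) : List NMono := e.flatMap fun q => (expandBrackets q.2).map fun t => (q.1 * t.1, t.2)

/-- resolve the names of one monomial against the example's printed subgraph names (`none` if a name is not a subgraph of the example)
(plumbing) [folklore] -/
def KExample.resolveFactors (ex : KExample) : List (String × Sym) → Option (List (ℕ × Sym))
  | [] => some []
  | (nm, o) :: rest =>
    match ex.resolve nm, ex.resolveFactors rest with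
    | some i, some l => some ((i, o) :: l)
    | _, _ => none

/-- resolve a printed expression (expanded) into index-based terms (plumbing) [folklore] -/
def KExample.resolveAll (ex : KExample) : List NMono → Option (List Term)
  | [] => some []
  | t :: rest =>
    match ex.resolveFactors t.2, ex.resolveAll rest with
    | some l, some ls => some ((t.1, canon l) :: ls)
    | _, _ => none

/-! ## §3 [69]'s 2-loop on-shell table (ZhETF 149 p.1170 Table 1 = arXiv:1507.06435v3 `table_2loop_onshell`) VERBATIM, and its certificates -/

/-- [69] Fig. 2 graph 1 (ladder): proper UV-divergent subgraph abc, vertexlike, ∈ 𝕴[G]. [cite: Volkov2016, §4 Table 1 row 1, Table 2 row 1 (ZhETF 149 p.1170, p.1172)] -/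
def gLadder : KExample := { subs := [⟨"abc", ["a", "b", "c"], .vertex, true, false⟩], overlaps := [] }
/-- graph 2 (crossed): no proper UV-divergent subgraph. [cite: Volkov2016, §4 Table 1 row 2 (ZhETF 149 p.1170)] -/
def gCrossed : KExample := { subs := [], overlaps := [] }
/-- graphs 3–4: a vertexlike subgraph bcd ∉ 𝕴[G]. [cite: Volkov2016, §4 Table 1 rows 3–4, Table 2 rows 3–4 (ZhETF 149 p.1170, p.1172)] -/
def gVertex : KExample := { subs := [⟨"bcd", ["b", "c", "d"], .vertex, false, false⟩], overlaps := [] }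
/-- graphs 5–6: an electron self-energy subgraph bc. [cite: Volkov2016, §4 Table 1 rows 5–6 (ZhETF 149 p.1170)] -/
def gSelfEnergy : KExample := { subs := [⟨"bc", ["b", "c"], .leptonSE, false, false⟩], overlaps := [] }
/-- graph 7: the photon self-energy subgraph de. [cite: Volkov2016, §4 Table 1 row 7 (ZhETF 149 p.1170)] -/
def gVacPol : KExample := { subs := [⟨"de", ["d", "e"], .photonSE, false, false⟩], overlaps := [] }

/-- The seven 2-loop graphs in Table 1's row order. [cite: Volkov2016, §4 Table 1 (ZhETF 149 p.1170)] -/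
def table1Graphs : List KExample := [gLadder, gCrossed, gVertex, gVertex, gSelfEnergy, gSelfEnergy, gVacPol]

/-- Cross-check with `ForestFormulaCases`: forgetting the kinds gives EXACTLY that file's data `table2_2016_graphs` for [69]'s Table 2 (same
subgraphs, same 𝕴-membership, same 2023 attributes). [cite: Volkov2016, §4 Tables 1–2 (ZhETF 149 p.1170, p.1172)] -/
theorem table1Graphs_toExample :
    table1Graphs.map (fun g => (g.toExample.subs, g.toExample.overlaps)) = table2_2016_graphs.map (fun x => (x.subs, x.overlaps)) := by
  decide

/-- the printed factor «A_{nm}» (plumbing) [folklore] -/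
private abbrev A_ (nm : String) : String × Sym := (nm, .op .A)
/-- the printed factor «L_{nm}» (plumbing) [folklore] -/
private abbrev L_ (nm : String) : String × Sym := (nm, .op .L)
/-- the printed factor «U_{nm}» (plumbing) [folklore] -/
private abbrev U_ (nm : String) : String × Sym := (nm, .op .U)
/-- the printed factor «B_{nm}» (plumbing) [folklore] -/
private abbrev B_ (nm : String) : String × Sym := (nm, .B)

/-- Table 1, column «Операторное выражение» (operator expression), rows 1–7 VERBATIM: «1: A_G − A_G L_abc; 2: A_G; 3: A_G − A_G L_bcd;
4: A_G − A_G L_bcd; 5: A_G − A_G B_bc; 6: A_G − A_G B_bc; 7: A_G − A_G U_de».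
[cite: Volkov2016, §4 Table 1 column 2 (ZhETF 149 p.1170; arXiv:1507.06435v3 tex l.566–581)] -/
def table1OpExpr : List NExpr :=
  [ [(1, [[(1, [A_ "G"])]]), (-1, [[(1, [A_ "G", L_ "abc"])]])],
    [(1, [[(1, [A_ "G"])]])],
    [(1, [[(1, [A_ "G"])]]), (-1, [[(1, [A_ "G", L_ "bcd"])]])],
    [(1, [[(1, [A_ "G"])]]), (-1, [[(1, [A_ "G", L_ "bcd"])]])],
    [(1, [[(1, [A_ "G"])]]), (-1, [[(1, [A_ "G", B_ "bc"])]])],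
    [(1, [[(1, [A_ "G"])]]), (-1, [[(1, [A_ "G", B_ "bc"])]])],
    [(1, [[(1, [A_ "G"])]]), (-1, [[(1, [A_ "G", U_ "de"])]])] ]

/-- Table 1, column «Разность» (the difference «между ними и выражениями из табл. 2» = on-shell expression MINUS the Table-2 expression),
rows 1–7 VERBATIM: «1: (L_G − U_G)A_abc − A_G(L_abc − U_abc); 2: 0; 3: A_G(U_bcd − L_bcd); 4: A_G(U_bcd − L_bcd); 5: A_G(U_bc − B_bc);
6: A_G(U_bc − B_bc); 7: 0» (brackets kept as brackets).
[cite: Volkov2016, §4 Table 1 column 3 (ZhETF 149 p.1170)] -/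
def table1Diff : List NExpr :=
  [ [(1, [[(1, [L_ "G"]), (-1, [U_ "G"])], [(1, [A_ "abc"])]]), (-1, [[(1, [A_ "G"])], [(1, [L_ "abc"]), (-1, [U_ "abc"])]])],
    [],
    [(1, [[(1, [A_ "G"])], [(1, [U_ "bcd"]), (-1, [L_ "bcd"])]])],
    [(1, [[(1, [A_ "G"])], [(1, [U_ "bcd"]), (-1, [L_ "bcd"])]])],
    [(1, [[(1, [A_ "G"])], [(1, [U_ "bc"]), (-1, [B_ "bc"])]])],
    [(1, [[(1, [A_ "G"])], [(1, [U_ "bc"]), (-1, [B_ "bc"])]])],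
    [] ]

/-- The arXiv e-print (1507.06435v3, tex l.572–574) prints rows 3–4 of the difference column as «A_G(U_{abc} − L_{abc})»; the journal prints
bcd (the subgraph of graphs 3–4 in both tables). [cite: Volkov2016, §4 Table 1 rows 3–4 (arXiv:1507.06435v3 tex l.572–574 vs ZhETF 149 p.1170)] -/
def eprintDiffRow34 : NExpr := [(1, [[(1, [A_ "G"])], [(1, [U_ "abc"]), (-1, [L_ "abc"])]])]

/-- **Table 1's operator-expression column IS §IV A's sum**, row by row: each printed on-shell expression, names resolved, is exactly (as a
multiset of signed terms) «Σ_{F∋G} (−1)^n A_G S_{G₁}…S_{G_n}» over the graph's forests with [69]'s operators L / B / U by kind.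
[cite: Volkov2016, §4 Table 1 (ZhETF 149 p.1170)] [cite: Volkov2024PRD109, §IV A (arXiv v4 p.11 L4–L11; tex l.469–479)] -/
theorem table1OpExpr_eq_onShell :
    (List.zip table1OpExpr table1Graphs).all
      (fun r => decide ((r.2.resolveAll (expandN r.1)).map (fun ts => decide (ts.Perm (r.2.onShellTerms S_69))) = some true)) = true := by
  decide

/-- **Table 1's difference column IS the difference**, row by row: the printed «Разность», brackets expanded and names resolved, equals
(as a formal ℤ-combination of products of single operators, «(L − U)» meaning L − U) the printed on-shell expression MINUS [69]'s Table-2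
expression as typed in `ForestFormulaCases.table2_2016`. [cite: Volkov2016, §4 Table 1 column 3 and Table 2 (ZhETF 149 p.1170, p.1172)] -/
theorem table1Diff_eq_sub :
    (List.zip (List.zip table1Diff table1OpExpr) (List.zip table1Graphs table2_2016)).all
      (fun r => decide (
        (r.2.1.resolveAll (expandN r.1.1)).bind (fun d =>
          (r.2.1.resolveAll (expandN r.1.2)).map fun os =>
            fsEq (unfoldAll d) (unfoldAll (os ++ fsNeg ((expand r.2.2).map liftTerm)))) = some true)) = true := by
  decide

/-- The e-print's rows 3–4 «A_G(U_{abc} − L_{abc})» do not resolve on graphs 3–4 (their subgraph is bcd); with abc ↦ bcd they are the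
journal's rows. [cite: Volkov2016, §4 Table 1 rows 3–4 (arXiv:1507.06435v3 tex l.572–574; ZhETF 149 p.1170)] -/
theorem eprintDiffRow34_resolves_iff_renamed :
    gVertex.resolveAll (expandN eprintDiffRow34) = none ∧
    (expandN eprintDiffRow34).map (fun t => (t.1, t.2.map fun q => (if q.1 = "abc" then "bcd" else q.1, q.2))) =
      expandN (table1Diff[2]!) := by
  decide

/-- **§IV B's substitution applied to Table 1** gives §IV A's expression: for each of the seven graphs, the printed on-shell column with
U ↦ U₀ on the photonic subgraph (nothing else to rename there) is exactly «Σ_{F∋G} (−1)^n A_G S_{G₁}…S_{G_n}» with S = L / B / U₀.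
[cite: Volkov2024PRD109, §IV A–B (arXiv v4 p.11 L4–L11, L29–L30; tex l.469–491)] -/
theorem table1OpExpr_subst_eq_IVA :
    (List.zip table1OpExpr table1Graphs).all
      (fun r => decide ((r.2.resolveAll (expandN r.1)).map (fun ts => decide ((r.2.substTerms ts).Perm (r.2.onShellTerms S_IVA))) = some true))
      = true := by
  decide

/-- **§IV B's substitution applied to [69]'s Table 2** gives the 2023 forest formula: for each of the seven graphs, `table2_2016`'s row with
U ↦ U₁ (leptonic subgraphs) / U₀ (the photonic one) and (L − U) ↦ (L − U₁) is exactly the 2023 case table's forest sum (`S23`, ξ = 1) on the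
same data — rows 1 and 5 are PRD 109 §III's printed «A_G − A_G (U₁)_{abc} − (L − U₁)_G A_{abc}», «A_G − A_G (U₁)_{bc}»
(`ForestFormulaCases.sec3_2023_twoLoop_eq_forest`); here all seven.
[cite: Volkov2024PRD109, §IV B first paragraph (arXiv v4 p.11 L29–L30; tex l.491); §II–§III (tex l.300–411)] -/
theorem table2_subst_eq_S23 :
    (List.zip table2_2016 table1Graphs).all
      (fun r => decide ((r.2.substTerms ((expand r.1).map liftTerm)).Perm
        ((r.2.toExample.forestTerms (S23 false)).map liftTerm))) = true := by
  decide

/-- Hence the 2023 difference column (in-place on-shell MINUS the new method, graph by graph) is [69]'s difference column with the same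
substitution: «1: (L_G − (U₁)_G)A_abc − A_G(L_abc − (U₁)_abc); 2: 0; 3–4: A_G((U₁)_bcd − L_bcd); 5–6: A_G((U₁)_bc − B_bc); 7: 0».
[cite: Volkov2024PRD109, §IV A–B (arXiv v4 p.11; tex l.469–491)] [cite: Volkov2016, §4 Table 1 (ZhETF 149 p.1170)] -/
theorem table1Diff_subst_eq_sub23 :
    (List.zip (List.zip table1Diff table1OpExpr) (List.zip table1Graphs table2_2016)).all
      (fun r => decide (
        (r.2.1.resolveAll (expandN r.1.1)).bind (fun d =>
          (r.2.1.resolveAll (expandN r.1.2)).map fun os =>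
            fsEq (unfoldAll (r.2.1.substTerms d))
              (unfoldAll (r.2.1.substTerms os ++ fsNeg (r.2.1.substTerms ((expand r.2.2).map liftTerm))))) = some true)) = true := by
  decide

/-! ### «As shown in this table, the contribution of the graph 1 to a_{e,1} − a^new_{e,1} is equal to zero»

Row 1's difference «(L_G − U_G)A_abc − A_G(L_abc − U_abc)» vanishes once each operator O applied to a (sub)graph is replaced by its number
O′ times the reduced amplitude — PRD 109 §IV C's «value of the node (l, O, r) is OΓ_l … the contribution of the layer tree is the product of
the node values» — and BOTH layers of the ladder (G with abc shrunk; abc itself) are valued on the same amplitude ⟦the one-loop vertex: the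
seat's reading of WHY the two printed products cancel; the text prints only the conclusion⟧. Typed as: for every valuation of (member,
operator) in a commutative ring that agrees on members 0 and 1, the expanded difference evaluates to 0. -/

/-- value of a resolved term under a valuation of single operators (product over the factors) (plumbing) [folklore] -/
def evalTerms {R : Type*} [CommRing R] (v : ℕ → Sym → R) (ts : List Term) : R :=
  (ts.map fun t => (t.1 : R) * (t.2.map fun q => v q.1 q.2).prod).sum

/-- [69] §4: «Из табл. 1 видно, что вклад графа 1 в разность a_{e,1} − a^new_{e,1} равен нулю» — for every layer valuation that values
the two layers of the ladder alike (v 0 = v 1), row 1's difference evaluates to zero.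
[cite: Volkov2016, §4 sentence after Table 1 (ZhETF 149 p.1170; arXiv:1507.06435v3 tex l.585–586)]
[cite: Volkov2024PRD109, §IV C «the contribution of the layer tree … is the product of the node values» (arXiv v4 p.14; tex l.618–622)] -/
theorem row1Diff_eval_eq_zero {R : Type*} [CommRing R] (v : ℕ → Sym → R) (hv : v 0 = v 1) :
    ((gLadder.resolveAll (expandN (table1Diff[0]!))).map fun d => evalTerms v (unfoldAll d)) = some 0 := by
  have h : gLadder.resolveAll (expandN (table1Diff[0]!)) =
      some [(1, [(0, .op .L), (1, .op .A)]), (-1, [(0, .op .U), (1, .op .A)]), (-1, [(0, .op .A), (1, .op .L)]),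
        (1, [(0, .op .A), (1, .op .U)])] := by decide
  rw [h]
  simp [unfoldAll, unfoldTerm, unfoldOne, canon, evalTerms, hv]
  ring

/-! ## §4 [69] §4's two-line lemma in the γ-algebra vocabulary of `WardIdentityPreservation`, with §IV A's B′ — and ONE PRINT-CHECK DATUM on [69] eq. (17) -/

open WardPreservation

variable {A : Type*} [NormedRing A] [NormedAlgebra ℝ A]

/-- [69] (8) (arXiv form): «UΓ_μ = (a(m²) + C_U d(m²))γ_μ, where C_U is an arbitrary constant» — the number multiplying γ_μ (the journal,
ZhETF 149 (8) p.1167, prints C_U = 0: «UΓ_μ = a(m²)γ_μ»). [cite: Volkov2016, §2.2 eq. (8) (ZhETF 149 p.1167; arXiv:1507.06435v3 tex l.331–339)] -/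
def uPrime2016 (CU m : ℝ) (V : Vertex) : ℝ := V.a (m ^ 2) + CU * V.d (m ^ 2)

/-- [69] §2.2: «UΣ(p) = a(m²) + b(m²)p̂» for Σ(p) = a(p²) + b(p²)p̂ ((6); here Σ = r + s p̂ as in PRD 109 (13)) — «заметим, что это отличается
от обычной перенормировки на массовой поверхности». [cite: Volkov2016, §2.2 eq. (6) and the display after it (ZhETF 149 p.1167; arXiv:1507.06435v3 tex l.321–328)] -/
def uAmp2016 (m : ℝ) (S : SelfEnergy) (γ : Fin 4 → A) (p : Fin 4 → ℝ) : A :=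
  S.r (m ^ 2) • (1 : A) + S.s (m ^ 2) • sl γ p

/-- [69] footnote 10: «по определению Σ(m) = a(m²) + m b(m²)». [cite: Volkov2016, §4 fn 10 (ZhETF 149 p.1170; arXiv:1507.06435v3 tex l.558–559)] -/
def sigmaAtM (m : ℝ) (S : SelfEnergy) : ℝ := S.r (m ^ 2) + m * S.s (m ^ 2)

/-- [69] eq. (17) AS PRINTED (journal and e-print alike): «BΣ(p) = Σ(m) + (p̂ − m)(b(m²) + 2a′(m²) + 2m b′(m²))» — the bracket, in PRD 109's
letters s(m²) + 2r′(m²) + 2m s′(m²). [cite: Volkov2016, §4 eq. (17) (ZhETF 149 p.1170; arXiv:1507.06435v3 tex l.555–557)] -/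
def bPrime2016 (m : ℝ) (S : SelfEnergy) : ℝ := S.s (m ^ 2) + 2 * S.r' (m ^ 2) + 2 * m * S.s' (m ^ 2)

/-- (BΣ)(p) with (17)'s bracket: Σ(m)·1 + [b(m²) + 2a′(m²) + 2m b′(m²)](p̂ − m·1). [cite: Volkov2016, §4 eq. (17) (ZhETF 149 p.1170)] -/
def bAmp2016 (m : ℝ) (S : SelfEnergy) (γ : Fin 4 → A) (p : Fin 4 → ℝ) : A :=
  sigmaAtM m S • (1 : A) + bPrime2016 m S • (sl γ p - m • (1 : A))

/-- Σ(m) of [69] fn 10 is PRD 109's M′Σ (14). [cite: Volkov2016, §4 fn 10 (ZhETF 149 p.1170)] [cite: Volkov2024PRD109, §II eq. (14) (arXiv v4 p.6 L19; tex l.275–277)] -/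
theorem sigmaAtM_eq_mPrime (m : ℝ) (S : SelfEnergy) : sigmaAtM m S = S.mPrime m := by
  unfold sigmaAtM SelfEnergy.mPrime; ring

/-- [69]'s UΣ is PRD 110 (7) at M² = m² («In old calculations we used M² = m²»). [cite: Volkov2016, §2.2 (ZhETF 149 p.1167)] [cite: Volkov2024, §III eq. (7) and «In old calculations we used M² = m²» (arXiv v2 p.8; tex l.430–441)] -/
theorem uAmp2016_eq_uAmp_self (m : ℝ) (S : SelfEnergy) (γ : Fin 4 → A) (p : Fin 4 → ℝ) :
    uAmp2016 m S γ p = S.uAmp (m ^ 2) m γ p := by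
  rw [SelfEnergy.uAmp_self]; rfl

/-- PRD 109 §IV A's B′ and [69] (17)'s bracket differ by 2(m − 1)(r′(m²) + m s′(m²)) — one power of m in each derivative term; they agree at
m = 1. [cite: Volkov2024PRD109, §IV A (arXiv v4 p.11 L22; tex l.483)] [cite: Volkov2016, §4 eq. (17) (ZhETF 149 p.1170)] -/
theorem bPrime_sub_bPrime2016 (m : ℝ) (S : SelfEnergy) :
    S.bPrime m - bPrime2016 m S = 2 * (m - 1) * (S.r' (m ^ 2) + m * S.s' (m ^ 2)) := by
  unfold SelfEnergy.bPrime bPrime2016; ring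

/-- At m = 1 the two B′ coincide. [cite: Volkov2024PRD109, §IV A (tex l.483)] [cite: Volkov2016, §4 eq. (17) (ZhETF 149 p.1170)] -/
theorem bPrime2016_eq_bPrime_one (S : SelfEnergy) : bPrime2016 1 S = S.bPrime 1 := by
  have h := bPrime_sub_bPrime2016 1 S
  simp only [sub_self, mul_zero, zero_mul] at h
  linarith

variable {γ : Fin 4 → A}

/-- **[69] §4 lemma, first claim**: «если … имеет место тождество Уорда Γ_μ(p,0) = −∂Σ(p)/∂p^μ и выполнено UΓ_μ = Cγ_μ, то будет справедливо
равенство UΣ(p) = Σ(m) − C(p̂ − m)» — for every Ward pair (e = 1), every C_U and every m, with C = a(m²) + C_U d(m²) the number in UΓ_μ = Cγ_μ.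
[cite: Volkov2016, §4 lemma after Table 1 (ZhETF 149 p.1170; arXiv:1507.06435v3 tex l.587–598)] -/
theorem lemma69_uSigma (hγ : IsDirac γ) [Nontrivial A] {V : Vertex} {S : SelfEnergy} (h : WardIdentity γ 1 V S)
    (CU m : ℝ) (p : Fin 4 → ℝ) :
    uAmp2016 m S γ p = sigmaAtM m S • (1 : A) - uPrime2016 CU m V • (sl γ p - m • (1 : A)) := by
  obtain ⟨ha, -, -, hd⟩ := h.coeff hγ (m ^ 2)
  simp only [uAmp2016, sigmaAtM, uPrime2016, ha, hd, one_mul, mul_zero, add_zero, smul_sub, smul_smul, add_smul, neg_smul]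
  module

/-- **[69] §4 lemma, second claim, with PRD 109 §IV A's B**: «Если при этих же предположениях выполнено (U − L)Γ_μ = C₁γ_μ, то имеет место
(U − B)Σ(p) = −C₁(p̂ − m)» — holds for every Ward pair, every C_U and every m when (BΣ)(p) = [B′Σ](p̂ − m) + M′Σ with
B′Σ = s(m²) + 2m r′(m²) + 2m² s′(m²); here C₁ = [a(m²) + C_U d(m²)] − L′Γ.
[cite: Volkov2016, §4 lemma after Table 1 (ZhETF 149 p.1170; arXiv:1507.06435v3 tex l.598–601)] [cite: Volkov2024PRD109, §IV A (arXiv v4 p.11 L22; tex l.483)] -/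
theorem lemma69_uSubB (hγ : IsDirac γ) [Nontrivial A] {V : Vertex} {S : SelfEnergy} (h : WardIdentity γ 1 V S)
    (CU m : ℝ) (p : Fin 4 → ℝ) :
    uAmp2016 m S γ p - S.bAmp m γ p = -((uPrime2016 CU m V - V.lPrime m) • (sl γ p - m • (1 : A))) := by
  obtain ⟨ha, hb, hc, hd⟩ := h.coeff hγ (m ^ 2)
  simp only [uAmp2016, SelfEnergy.bAmp, SelfEnergy.bPrime, SelfEnergy.mPrime, uPrime2016, Vertex.lPrime, ha, hb, hc, hd, one_mul,
    mul_zero, add_zero, smul_sub, smul_smul, add_smul, sub_smul, neg_smul, mul_neg]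
  module

/-- a scalar multiple of (p̂ − m·1) vanishing for every momentum p forces the scalar to vanish (test p = 0 and p = e₀). [folklore] -/
private theorem smul_slash_sub_eq_zero_iff (hγ : IsDirac γ) [Nontrivial A] (c m : ℝ) :
    (∀ p : Fin 4 → ℝ, c • (sl γ p - m • (1 : A)) = 0) ↔ c = 0 := by
  constructor
  · intro hp
    have h0 := hp 0
    have h1 := hp (e 0)
    have hsl0 : sl γ (0 : Fin 4 → ℝ) = 0 := by simp [sl]
    have hsl1 : sl γ (e 0) = γ 0 := by unfold sl e; simp [Finset.sum_ite_eq']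
    rw [hsl0, zero_sub] at h0
    rw [hsl1] at h1
    have h2 : c • γ 0 = 0 := by
      have h3 : c • γ 0 = c • (γ 0 - m • (1 : A)) - c • (-(m • (1 : A))) := by rw [smul_sub, smul_neg]; abel
      rw [h3, h1, h0, sub_zero]
    rcases smul_eq_zero.mp h2 with h3 | h3
    · exact h3
    · exfalso
      have h00 : γ 0 * γ 0 = (1 : A) := by rw [gamma_sq hγ 0]; simp
      rw [h3, zero_mul] at h00
      exact zero_ne_one h00
  · intro hc p
    rw [hc, zero_smul]

/-- **PRINT-CHECK DATUM on [69] eq. (17).** With (17)'s bracket b(m²) + 2a′(m²) + 2m b′(m²) AS PRINTED, [69]'s own second claim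
«(U − B)Σ(p) = −C₁(p̂ − m)» holds for a Ward pair (all p) IF AND ONLY IF (m − 1)(a′(m²) + m b′(m²)) = 0 — e.g. at m = 1, where (17) and PRD 109
§IV A's B′ = s + 2m r′ + 2m² s′ coincide; with §IV A's B′ it holds for every m (`lemma69_uSubB`). Reading: (17) omits one power of m in
each derivative term; PRD 109 §IV A prints the homogeneous form; no printed conclusion of [69] §4 depends on m ≠ 1.
[cite: Volkov2016, §4 eq. (17) and the lemma after Table 1 (ZhETF 149 p.1170; arXiv:1507.06435v3 tex l.555–601)] [cite: Volkov2024PRD109, §IV A (arXiv v4 p.11 L22; tex l.483)] -/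
theorem lemma69_uSubB_asPrinted_iff (hγ : IsDirac γ) [Nontrivial A] {V : Vertex} {S : SelfEnergy} (h : WardIdentity γ 1 V S)
    (CU m : ℝ) :
    (∀ p : Fin 4 → ℝ, uAmp2016 m S γ p - bAmp2016 m S γ p = -((uPrime2016 CU m V - V.lPrime m) • (sl γ p - m • (1 : A)))) ↔
      (m - 1) * (S.r' (m ^ 2) + m * S.s' (m ^ 2)) = 0 := by
  obtain ⟨ha, hb, hc, hd⟩ := h.coeff hγ (m ^ 2)
  have key : ∀ p : Fin 4 → ℝ,
      (uAmp2016 m S γ p - bAmp2016 m S γ p - -((uPrime2016 CU m V - V.lPrime m) • (sl γ p - m • (1 : A)))) =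
        (2 * ((m - 1) * (S.r' (m ^ 2) + m * S.s' (m ^ 2)))) • (sl γ p - m • (1 : A)) := by
    intro p
    simp only [uAmp2016, bAmp2016, bPrime2016, sigmaAtM, uPrime2016, Vertex.lPrime, ha, hb, hc, hd, one_mul, mul_zero, add_zero,
      smul_sub, smul_smul, add_smul, sub_smul, neg_smul, mul_neg]
    module
  constructor
  · intro hp
    have h2 : ∀ p : Fin 4 → ℝ, (2 * ((m - 1) * (S.r' (m ^ 2) + m * S.s' (m ^ 2)))) • (sl γ p - m • (1 : A)) = 0 := by
      intro p; rw [← key p, hp p, sub_self]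
    have h3 := (smul_slash_sub_eq_zero_iff hγ _ m).mp h2
    linarith
  · intro h0 p
    have h2 := key p
    rw [h0, mul_zero, zero_smul] at h2
    exact sub_eq_zero.mp h2

/-- The same two claims read with PRD 110's U at general M² (`SelfEnergy.uAmp`, `Vertex.uPrime`): for every Ward pair and every M², m,
(UΣ)(p) − (BΣ)(p) = −(U′Γ − L′Γ)(p̂ − m) with §IV A's B — the 2023 form of [69]'s lemma used in §IV B («It equals 0, because L′Γ₁ = −B′Σ₁»).
[cite: Volkov2024PRD109, §IV A–B (arXiv v4 p.11 L22, p.14 L15; tex l.483, l.595)] [cite: Volkov2024, §III eq. (6)–(7) (arXiv v2 p.8; tex l.426–432)] -/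
theorem uAmp_sub_bAmp (hγ : IsDirac γ) [Nontrivial A] {V : Vertex} {S : SelfEnergy} (h : WardIdentity γ 1 V S)
    (M2 m : ℝ) (p : Fin 4 → ℝ) :
    S.uAmp M2 m γ p - S.bAmp m γ p = -((V.uPrime M2 - V.lPrime m) • (sl γ p - m • (1 : A))) := by
  have h1 := uPrime_vertex_eq hγ h M2
  have h2 := lPrime_eq_neg_bPrime hγ h m
  rw [one_mul] at h1 h2
  simp only [SelfEnergy.uAmp, SelfEnergy.bAmp, h1, h2, sub_neg_eq_add, neg_smul, smul_sub, add_smul]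
  abel

end OnShell

/-! ## §5 The model: the Dirac matrices (`Volkov2020.DiracModel`) — the lemma has content -/

namespace OnShell

open WardPreservation Volkov2020.DiracModel

section Model

attribute [local instance] Matrix.linftyOpNormedRing Matrix.linftyOpNormedAlgebra

/-- In the Dirac-matrix model every self-energy shape Σ = r + s p̂ has a Ward partner (`model_wardIdentity`), and [69]'s lemma (both
claims, with §IV A's B) holds for it with content: U′Γ = −s(m²), L′Γ = −B′Σ.
[cite: Volkov2016, §4 lemma after Table 1 (ZhETF 149 p.1170)] [cite: Volkov2024PRD109, §IV A (arXiv v4 p.11 L22; tex l.483)] -/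
theorem model_lemma69 (S : SelfEnergy) (CU m : ℝ) (p : Fin 4 → ℝ) :
    uAmp2016 m S diracGamma p = sigmaAtM m S • (1 : Matrix (Fin 4) (Fin 4) ℂ)
        - uPrime2016 CU m (S.wardVertex 1) • (sl diracGamma p - m • (1 : Matrix (Fin 4) (Fin 4) ℂ)) ∧
      uAmp2016 m S diracGamma p - S.bAmp m diracGamma p =
        -((uPrime2016 CU m (S.wardVertex 1) - (S.wardVertex 1).lPrime m) • (sl diracGamma p - m • (1 : Matrix (Fin 4) (Fin 4) ℂ))) ∧
      uPrime2016 CU m (S.wardVertex 1) = -S.s (m ^ 2) ∧ (S.wardVertex 1).lPrime m = -S.bPrime m :=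
  ⟨lemma69_uSigma isDirac_diracGamma (model_wardIdentity 1 S) CU m p,
    lemma69_uSubB isDirac_diracGamma (model_wardIdentity 1 S) CU m p,
    by simp [uPrime2016, SelfEnergy.wardVertex],
    by simpa using lPrime_eq_neg_bPrime isDirac_diracGamma (model_wardIdentity 1 S) m⟩

end Model

end OnShell

end Literature.MathematicalPhysics.QuantumFieldTheory.Volkov2024PRD109

end
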